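import Literature.AlgebraicGeometry.ShimuraVarieties.UnitaryBallLevelCovering
import Literature.NumberTheory.Transcendental.AnalytificationUnique
import HarnessLib

/-!
# A compact ball quotient has ONE algebraic model: equal ball data give isomorphic schemes

Let `D₁ : UnitaryBallUniformisationDatum 2 X₁`, `D₂ : UnitaryBallUniformisationDatum 2 X₂` be ball uniformizations
`Γ₁\𝔹² ≅ X₁(ℂ)`, `Γ₂\𝔹² ≅ X₂(ℂ)` of two smooth projective surfaces over `ℂ` with THE SAME complex hermitian space
(`D₁.Hℂ = D₂.Hℂ`, so the same negative cone and the same ball) and THE SAME group read in `GL₃(ℂ)` (`Γ₁^{τ₁} = Γ₂^{τ₁}`).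

* `hom_ext_of_unif` — two morphisms `X₁ ⟶ Y` (`Y` smooth projective) agreeing on the points `unif₁ v` of the cone are
  equal: `unif₁` is onto `X₁(ℂ)` and complex points separate morphisms of smooth projective varieties
  (`hom_ext_of_isAnalytification`, read in any Hodge model of `X₁`).
* **`exists_iso_of_eq`** — there is an ISOMORPHISM OF `ℂ`-SCHEMES `e : X₁ ≅ X₂` lying over the uniformizations:
  `e.hom(ℂ) (unif₁ v) = unif₂ v` and `e.inv(ℂ) (unif₂ w) = unif₁ w` on the cone.  The two morphisms are the level coverings
  `UnitaryBallLevelCovering.exists_hom_map_unif_eq` in the two directions (holomorphic maps between smooth projective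
  varieties are algebraic: Arapura Cor. 15.4.6 = Mumford AG I (4.14), the tree THEOREM `arapura2012_cor_15_4_6_holds`, by
  which the record is discharged here); that they are INVERSE isomorphisms — not merely inverse on complex points — is Mumford
  AG I (4.15) «every compact complex manifold has at most one "algebraic structure"» (`hom_ext_of_unif`).  So a smooth
  projective surface together with a ball uniformisation by `(E, H, Γ)` is determined by `(H^{τ₁}, Γ^{τ₁})` up to an
  isomorphism fixed on points: THE ALGEBRAIC MODEL OF `Γ\𝔹²` IS UNIQUE.
* `nonempty_iso_of_eq`; `exists_iso_of_eq_of_nonempty` taking `Nonempty (HodgeModel 2 Xᵢ)` (e.g. from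
  `HodgeTheory.exists_isReal_hodgeModel_holds`) instead of Hodge models.

Hodge models `Aᵢ : HodgeModel 2 Xᵢ` (complex-manifold structures `Xᵢ^an`) are inputs of the holomorphy step only; the
conclusions do not mention them.  All statements are theorems; no definitions, no records, nothing posited.  The CONJUGATE
case (an isometry `g` with `g Γ₁^{τ₁} g⁻¹ = Γ₂^{τ₁}`) follows the same way from `UnitaryBallIsometricQuotients.exists_hom_hom`
+ `map_comp_apply_of_unif(')` and is deliberately not repeated here.

USE (cell pub-hodgecm2, TRANSPOSITION item (vi) S2, the (M-Sh) model match `hReach`, step «GAGA/Chow» of the S2-CRUX owner's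
reading): a connected component of Liu's `Sh(𝕍)_K ⊗_{E,ι₁} ℂ`, presented as a smooth projective surface `X_g` uniformised by
`(E, H_V, Γ_g)`, `Γ_g = U(V)(F) ∩ gKg⁻¹` ([Liu2021] App. C Prop. C.5 + the complex uniformisation of Shimura varieties), IS — by
`exists_iso_of_eq` — the tree's chosen Picard modular surface of the level `(Γ_g, gKg⁻¹)`; Albanese data transport along `e`.

References: D. Mumford, *Algebraic Geometry I: Complex Projective Varieties* (1981), §4B (4.14), (4.15) Corollary p. 67;
D. Arapura, *Algebraic Geometry over the Complex Numbers* (2012), §15.4 Cor. 15.4.6; N. Bergeron, J. Millson, C. Moeglin,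
Acta Math. 216 (2016), Introduction §1.1 (the congruence tower `S(Γ)`).

## Provenance

Literature file for the Hodge-ladder cell pub-hodgecm2 (COR-CM, stage 2), seat item6-p2 gen 7 (TRANSPOSITION item (vi),
S2 `supply`).  Every declaration is kernel-checked; no new records.
-/

noncomputable section

open Matrix Function Set
open scoped Manifold Topology
open Literature.NumberTheory.Transcendental
open Literature.AlgebraicGeometry.HodgeTheory (HodgeModel)
open Literature.AlgebraicGeometry.Motives (SchemeOver ComplexPoints AlgPoints)
open CategoryTheory

namespace Literature.AlgebraicGeometry.ShimuraVarieties.UnitaryBallModelUnique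

open Literature.AlgebraicGeometry.ShimuraVarieties UnitaryBallUniformisationDatum

variable {X₁ X₂ : SchemeOver ℂ} {D₁ : UnitaryBallUniformisationDatum 2 X₁} {D₂ : UnitaryBallUniformisationDatum 2 X₂}

/-! ### Complex points separate morphisms out of a ball quotient -/

/-- Two morphisms `u, v : X₁ ⟶ Y` out of a ball-uniformised smooth projective surface which agree on the points `unif₁ v`,
`v` in the cone (i.e. on all complex points, `unif₁` being onto) are equal — complex points separate morphisms of smooth
projective varieties (`hom_ext_of_isAnalytification`, read in any Hodge model of `X₁`).
[cite: Mumford1981, §4B (4.15) Corollary, p. 67] -/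
theorem hom_ext_of_unif {n : ℕ} {Y : SchemeOver ℂ} (D : UnitaryBallUniformisationDatum 2 X₁)
    (hY : Motives.IsSmoothProjective n Y) (A₁ : HodgeModel 2 X₁)
    {u v : X₁ ⟶ Y} (H : ∀ w ∈ D.cone, AlgPoints.map u (D.unif w) = AlgPoints.map v (D.unif w)) : u = v := by
  refine hom_ext_of_isAnalytification D.isSmoothProjective hY A₁.isAnalytification fun x ↦ ?_
  obtain ⟨w, hw, hwx⟩ := D.surjOn_unif (Set.mem_univ (A₁.toComplexPoints x))
  rw [← hwx]
  exact H w hw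

/-! ### Equal data: the algebraic model of `Γ\𝔹²` is unique -/

/-- **A compact ball quotient has one algebraic model.**  Two ball uniformizations with THE SAME complex hermitian space
(`D₁.Hℂ = D₂.Hℂ`) and THE SAME group in `GL₃(ℂ)` (`Γ₁^{τ₁} = Γ₂^{τ₁}`) of smooth projective surfaces `X₁`, `X₂` differ by an
isomorphism `e : X₁ ≅ X₂` of `ℂ`-schemes over the uniformizations: `e.hom(ℂ) (unif₁ v) = unif₂ v` and
`e.inv(ℂ) (unif₂ w) = unif₁ w` on the (common) cone.  The level coverings in the two directions
(`UnitaryBallLevelCovering.exists_hom_map_unif_eq`, GAGA = `arapura2012_cor_15_4_6_holds`) compose to the identity on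
complex points, hence to the identity (Mumford AG I (4.15): «at most one algebraic structure»).
[cite: Mumford1981, §4B (4.15) Corollary, p. 67] [cite: BergeronMillsonMoeglin2016Balls, Introduction §1.1] -/
theorem exists_iso_of_eq (A₁ : HodgeModel 2 X₁) (A₂ : HodgeModel 2 X₂) (hH : D₁.Hℂ = D₂.Hℂ)
    (hΓ : D₁.Γ.map (Matrix.GeneralLinearGroup.map D₁.τ₁) = D₂.Γ.map (Matrix.GeneralLinearGroup.map D₂.τ₁)) :
    ∃ e : X₁ ≅ X₂, (∀ v ∈ D₁.cone, AlgPoints.map e.hom (D₁.unif v) = D₂.unif v) ∧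
      (∀ w ∈ D₂.cone, AlgPoints.map e.inv (D₂.unif w) = D₁.unif w) := by
  obtain ⟨f, hf⟩ :=
    UnitaryBallLevelCovering.exists_hom_map_unif_eq arapura2012_cor_15_4_6_holds hH hΓ.le A₁ A₂
  obtain ⟨f', hf'⟩ :=
    UnitaryBallLevelCovering.exists_hom_map_unif_eq arapura2012_cor_15_4_6_holds hH.symm hΓ.ge A₂ A₁
  have hcone : D₁.cone = D₂.cone := UnitaryBallLevelCovering.cone_eq_of_Hℂ_eq hH
  have hff' : f ≫ f' = 𝟙 X₁ := by
    refine hom_ext_of_unif D₁ D₁.isSmoothProjective A₁ fun w hw ↦ ?_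
    rw [AlgPoints.map_comp_apply, hf w hw, hf' w (hcone ▸ hw), AlgPoints.map_id_apply]
  have hf'f : f' ≫ f = 𝟙 X₂ := by
    refine hom_ext_of_unif D₂ D₂.isSmoothProjective A₂ fun w hw ↦ ?_
    rw [AlgPoints.map_comp_apply, hf' w hw, hf w (hcone ▸ hw), AlgPoints.map_id_apply]
  exact ⟨⟨f, f', hff', hf'f⟩, hf, hf'⟩

/-- Isomorphism-class form of `exists_iso_of_eq`: equal ball data (`Hℂ`, `Γ^{τ₁}`) ⇒ `X₁ ≅ X₂`.
[cite: Mumford1981, §4B (4.15) Corollary, p. 67] -/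
theorem nonempty_iso_of_eq (A₁ : HodgeModel 2 X₁) (A₂ : HodgeModel 2 X₂) (hH : D₁.Hℂ = D₂.Hℂ)
    (hΓ : D₁.Γ.map (Matrix.GeneralLinearGroup.map D₁.τ₁) = D₂.Γ.map (Matrix.GeneralLinearGroup.map D₂.τ₁)) :
    Nonempty (X₁ ≅ X₂) :=
  let ⟨e, _⟩ := exists_iso_of_eq A₁ A₂ hH hΓ; ⟨e⟩

/-- `exists_iso_of_eq` with the Hodge models supplied by any existence statement (e.g.
`HodgeTheory.exists_isReal_hodgeModel_holds`). [cite: Mumford1981, §4B (4.15) Corollary, p. 67] -/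
theorem exists_iso_of_eq_of_nonempty (hA₁ : Nonempty (HodgeModel 2 X₁)) (hA₂ : Nonempty (HodgeModel 2 X₂))
    (hH : D₁.Hℂ = D₂.Hℂ)
    (hΓ : D₁.Γ.map (Matrix.GeneralLinearGroup.map D₁.τ₁) = D₂.Γ.map (Matrix.GeneralLinearGroup.map D₂.τ₁)) :
    ∃ e : X₁ ≅ X₂, (∀ v ∈ D₁.cone, AlgPoints.map e.hom (D₁.unif v) = D₂.unif v) ∧
      (∀ w ∈ D₂.cone, AlgPoints.map e.inv (D₂.unif w) = D₁.unif w) :=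
  let ⟨A₁⟩ := hA₁; let ⟨A₂⟩ := hA₂; exists_iso_of_eq A₁ A₂ hH hΓ

end Literature.AlgebraicGeometry.ShimuraVarieties.UnitaryBallModelUnique

end
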